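import Summits.BirchSwinnertonDyer.BirchSwinnertonDyer.Theorems.ByReductionTypeAtTwoTorsionEulerCharIneq
import Summits.BirchSwinnertonDyer.BirchSwinnertonDyer.Theorems.ByReductionTypeAtTwoMultTowerNS2LayerZeroEulerChar
import Literature.NumberTheory.EllipticCurves.IwasawaTowerTorsionFiniteProofs
import Literature.NumberTheory.EllipticCurves.PAdicBSDKatoFiniteProofs
import HarnessLib

set_option linter.dupNamespace false -- `…BirchSwinnertonDyer.BirchSwinnertonDyer…` is the cell's nested layout (D-0017)
set_option autoImplicit false

/-!
# Greenberg's «analogue of Theorem 4.1» (LNM 1716 p. 112) over `ℚ` at a NON-SPLIT multiplicative prime WITH RATIONAL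
# `p`-TORSION — the UPPER-HALF direction `f_E(0)·#E(ℚ)(p)² ∈ #Sel_{p^∞}(E/ℚ) · ∏_{v∈S} #𝒦_{v,0}[p^∞] · ℤ_p`, modulo Cassels' count at `v₀`

Cell `bsd-2adic` (run/shared/lean/pub/bsd-2adic/), seat `bsd-2adic-tower-1` GEN 31; `--supports stmt-BirchSwinnertonDyer-19922`
(helper; TOWER rows at a non-split `2` with `E(ℚ)[2] ≠ 0`). THEOREMS ONLY (no definition, no named fact, no `sorry`); closes no
item; nothing booked; no display re-keyed (D-0152); BSD is not proved by any of this.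

R. Greenberg, LNM 1716 (1999), §4 Thm. 4.1 (p. 102) and pp. 112–113: `f_E(0) ∼ (∏ l_v)(∏ c_v^{(p)}) |Sel_E(F)_p| / |E(F)_p|²`.
With `E(F)_p ≠ 0` the proof runs through Lemma 4.7 `|ker g|·|E(F)_p| = |ker r|·|(Sel_∞)_Γ|`. The tree has Lemmas 4.2/4.3 with
the factor `#E[p^∞]^{Γ_K}` (`SelmerDualData.constantCoeff_charGenerator_mul_natCard_of_finite_selmerGroup_rat`:
`f(0)·#(Sel_∞)_γ·#E[p^∞]^{Γ_ℚ} = u·#Sel·#(A₀/Sel₀)`) and, after this seat's parts 1–3c, the «≥» half of Lemma 4.7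
(`TorsionEulerChar.prod_natCard_mul_natCard_endCoinvariants_le`: `∏#𝒦·#(Sel_∞)_γ ≤ #(A₀/Sel₀)·#C`, `C` any receptacle for
Cassels' cokernel at an auxiliary place `v₀`). Multiplying out (all the orders are powers of `p`, so `≤` is `∣`):

* `natCard_fixedPoints_geomPrimaryTorsion_eq` — Galois descent `#E[p^∞]^{Γ_K} = #E(K)(p)` (any perfect `K`).
* `constantCoeff_mul_sq_eq_nonsplit_rat_of_defect` — for `W/ℚ` globally minimal, NON-SPLIT multiplicative at `p`, `κ` cyclotomic
  with topological generator `γ`, `Sel_{p^∞}(E/ℚ)` finite, ANY rational `p`-torsion, `S ⊇ {bad} ∪ {p}`, `v₀ ∉ S`, a receptacle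
  `δ : H¹(Γ_{ℚ_{v₀}}, E)(p) → C` with kernel `loc_{v₀}(U)` and **`#C ≤ #E(ℚ)(p)`** (Cassels' theorem with torsion, Prop. 4.13 —
  a displayed HYPOTHESIS here): `X` is finitely generated `Λ`-torsion and
  **`f(0)·#E(ℚ)(p)² = e · #Sel_{p^∞}(E/ℚ) · ∏_{v∈S} #𝒦_{v,0}[p^∞]` for some NON-ZERO `e ∈ ℤ_p`** (the upper-half direction; `e`
  is a unit iff Lemma 4.6^Γ holds, not claimed). Inputs: «DIV» any torsion (`InputsGreenbergShaTwoAnyTorsion…_real`, k4-p1),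
  local surjectivity at every finite place (`MultLocSurj…_all_nonsplit`, GEN 29), finiteness of the `𝒦_{v,0}` (GEN 28 / L3.3).

HONEST FRAMING: the one displayed hypothesis `#C ≤ #E(ℚ)(p)` is Cassels' cokernel count (p. 104) read at `v₀` — PRINT, to be
discharged by the finite-level Poitou–Tate count (X5 `SelfDualCount`, k4-p1 `CasselsCokernelTorsionCount`) in a sequel; the
conclusion is ONE direction of the printed display. Closes no item; no summit statement is proved; BSD is NOT proved by this.

References: [GreenbergLNM1716] Thm. 4.1 (p. 102), §4 pp. 104–108, 112–113, Prop. 4.13 (p. 122); [SilvermanAEC2009] VIII §1.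
-/

noncomputable section

open scoped Classical NumberField

open NumberField IsDedekindDomain Field

namespace Summit.BirchSwinnertonDyer.BirchSwinnertonDyer.Theorems.TorsionEulerChar

open Literature.NumberTheory.EllipticCurves Literature.NumberTheory.GaloisRepresentations
  WeierstrassCurve ZpExtension Literature.NumberTheory.EllipticCurves.IwasawaAlgebra
  Literature.NumberTheory.EllipticCurves.IwasawaDual
  Literature.NumberTheory.EllipticCurves.GreenbergVatsal2000 Literature.NumberTheory.EllipticCurves.GreenbergSelmer
  Literature.NumberTheory.EllipticCurves.Rank1Residual Summit.BirchSwinnertonDyer.Rank1Residual.X2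

/-! ## §0 `p`-groups and Galois descent for the rational `p`-primary torsion -/

/-- A finite additive group all of whose elements are killed by powers of `p` has `p`-power order (`IsPGroup.iff_card`).
[folklore] -/
private theorem exists_natCard_eq_pow (p : ℕ) [Fact p.Prime] {A : Type*} [AddCommGroup A] [Finite A]
    (h : ∀ a : A, ∃ k : ℕ, p ^ k • a = 0) : ∃ n : ℕ, Nat.card A = p ^ n := by
  have hG : IsPGroup p (Multiplicative A) := fun g ↦ by
    obtain ⟨k, hk⟩ := h (Multiplicative.toAdd g)
    exact ⟨k, by rw [← ofAdd_toAdd g, ← ofAdd_nsmul, hk, ofAdd_zero]⟩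
  obtain ⟨n, hn⟩ := (IsPGroup.iff_card (p := p) (G := Multiplicative A)).mp hG
  exact ⟨n, hn⟩

/-- **Galois descent for the `p`-primary torsion: `#E[p^∞]^{Γ_K} = #E(K)(p)`** for a Weierstrass curve over a perfect field:
`P ↦ P` is a bijection from the `p`-primary part of `E(K)` onto the `Γ_K`-fixed points of `E(K̄)[p^∞]`
(`exists_toGeomPoints_eq_of_forall_smul_eq`). The left side is the factor `|E(F)_p|` of Greenberg's Lemma 4.3 / Thm. 4.1 in the
tree's currency (`MulAction.fixedPoints Γ_K (geomPrimaryTorsion W p)`). [cite: SilvermanAEC2009, VIII §1]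
[cite: GreenbergLNM1716, §4 Lemma 4.3 (p. 103)] -/
theorem natCard_fixedPoints_geomPrimaryTorsion_eq {K : Type} [Field K] [PerfectField K] (W : WeierstrassCurve K) (p : ℕ) :
    Nat.card (MulAction.fixedPoints (absoluteGaloisGroup K) (geomPrimaryTorsion W p)) =
      Nat.card (AddCommGroup.primaryComponent W.toAffine.Point p) := by
  classical
  have hmem : ∀ P : AddCommGroup.primaryComponent W.toAffine.Point p,
      toGeomPoints W P ∈ geomPrimaryTorsion W p := fun P ↦ by
    obtain ⟨k, hk⟩ := (AddCommGroup.mem_primaryComponent).mp P.2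
    exact (AddCommGroup.mem_primaryComponent).mpr ⟨k, by rw [← map_nsmul, hk, map_zero]⟩
  let φ : AddCommGroup.primaryComponent W.toAffine.Point p →
      MulAction.fixedPoints (absoluteGaloisGroup K) (geomPrimaryTorsion W p) := fun P ↦
    ⟨⟨toGeomPoints W P, hmem P⟩, fun σ ↦ Subtype.ext (by
      rw [primaryComponent.coe_smul]; exact smul_toGeomPoints W σ P)⟩
  refine (Nat.card_congr (Equiv.ofBijective φ ⟨fun P Q hPQ ↦ ?_, fun m ↦ ?_⟩)).symm
  · have h := congrArg (fun x : MulAction.fixedPoints (absoluteGaloisGroup K) (geomPrimaryTorsion W p) ↦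
        ((x.1 : geomPrimaryTorsion W p) : geomPoints W)) hPQ
    exact Subtype.ext (toGeomPoints_injective W h)
  · have hfix : ∀ σ : absoluteGaloisGroup K, σ • ((m : geomPrimaryTorsion W p) : geomPoints W) = (m : geomPoints W) :=
      fun σ ↦ by rw [← primaryComponent.coe_smul, m.2 σ]
    obtain ⟨P, hP⟩ := exists_toGeomPoints_eq_of_forall_smul_eq W hfix
    obtain ⟨k, hk⟩ := (AddCommGroup.mem_primaryComponent).mp (m : geomPrimaryTorsion W p).2
    have hPk : p ^ k • P = 0 := toGeomPoints_injective W (by rw [map_nsmul, hP, map_zero, hk])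
    refine ⟨⟨P, (AddCommGroup.mem_primaryComponent).mpr ⟨k, hPk⟩⟩, Subtype.ext (Subtype.ext ?_)⟩
    exact hP

/-! ## §1 The upper-half Euler characteristic at a non-split multiplicative prime, any rational torsion, modulo Cassels' count -/

/-- **Greenberg's «analogue of Thm. 4.1» over `ℚ` at a NON-SPLIT multiplicative `p`, ANY rational `p`-torsion — UPPER-HALF
direction, modulo Cassels' count at an auxiliary place.** For `W/ℚ` globally minimal and elliptic, multiplicative but not split
multiplicative at `p`, `κ` the cyclotomic `ℤ_p`-extension with topological generator `γ`, `Sel_{p^∞}(E/ℚ)` finite, a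
Pontryagin-dual datum `D` with `char X(E/ℚ_∞) = (f)`, a finite `S ⊇ {bad} ∪ {p}`, an auxiliary `v₀ ∉ S`, and a receptacle
`δ : H¹(Γ_{ℚ_{v₀}}, E)(p) → C` (finite) with kernel `loc_{v₀}(U)` and `#C ≤ #E(ℚ)(p)` (Cassels' theorem with torsion, Prop. 4.13 —
HYPOTHESIS `hC`): `X` is finitely generated `Λ`-torsion and **`f(0) · #E(ℚ)(p)² = e · #Sel_{p^∞}(E/ℚ) · ∏_{v ∈ S} #𝒦_{v,0}[p^∞]`
with `e ∈ ℤ_p`, `e ≠ 0`** (Lemmas 4.2/4.3 with `#E[p^∞]^{Γ_ℚ} = #E(ℚ)(p)`, times the «≥» half of Lemma 4.7; all orders are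
powers of `p`). `e ∈ ℤ_pˣ` would be the full display (needs Lemma 4.6^Γ; not claimed).
[cite: GreenbergLNM1716, Thm. 4.1 (p. 102), §4 pp. 104–108 and pp. 112–113, Prop. 4.13 (p. 122)] -/
theorem constantCoeff_mul_sq_eq_nonsplit_rat_of_defect (p : ℕ) [hp : Fact p.Prime] (W : WeierstrassCurve ℚ)
    [W.IsGloballyMinimal] [W.IsElliptic] (hmult : W.HasMultiplicativeReductionAtPrime p)
    (hns : ¬ W.HasSplitMultiplicativeReductionAtPrime p) (κ : ZpExtension ℚ p) (hκ : κ.IsCyclotomic)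
    {γ : absoluteGaloisGroup ℚ} (hγ : κ.IsTopGenerator γ) (D : W.SelmerDualData κ γ) [Finite (W.selmerGroupPInfty p)]
    (S : Finset (HeightOneSpectrum (𝓞 ℚ))) (hS : ∀ v ∉ S, ((p : ℕ) : 𝓞 ℚ) ∉ v.asIdeal ∧ W.HasGoodReductionAt v)
    (v₀ : HeightOneSpectrum (𝓞 ℚ)) (hv₀ : v₀ ∉ S)
    {C : Type*} [AddCommGroup C] [Finite C]
    (δ : AddCommGroup.primaryComponent
      (discreteH1 (localSubgroup (⊤ : Subgroup (absoluteGaloisGroup ℚ)) (v₀.adicCompletion ℚ))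
        (localPoints W (v₀.adicCompletion ℚ))) p →+ C)
    (hδ : ∀ z : AddCommGroup.primaryComponent
        (discreteH1 (localSubgroup (⊤ : Subgroup (absoluteGaloisGroup ℚ)) (v₀.adicCompletion ℚ))
          (localPoints W (v₀.adicCompletion ℚ))) p, δ z = 0 ↔
      (z : discreteH1 (localSubgroup (⊤ : Subgroup (absoluteGaloisGroup ℚ)) (v₀.adicCompletion ℚ))
        (localPoints W (v₀.adicCompletion ℚ))) ∈
        AddSubgroup.map (W.localResOver p ⊤ (v₀.adicCompletion ℚ))
          (unramifiedOutside (⊤ : Subgroup (absoluteGaloisGroup ℚ)) (W.geomPrimaryTorsion p) p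
              ((↑S : Set (HeightOneSpectrum (𝓞 ℚ))) ∪ {v₀}) ⊓
            (⨅ v ∈ S, W.localKerOver p ⊤ (v.adicCompletion ℚ)) ⊓
            (⨅ w : InfinitePlace ℚ, W.localKerOver p ⊤ w.Completion)))
    (hC : Nat.card C ≤ Nat.card (AddCommGroup.primaryComponent W.toAffine.Point p))
    (f : IwasawaAlgebra p) (hf : Module.charIdeal (IwasawaAlgebra p) D.X = Ideal.span {f}) :
    Module.Finite (IwasawaAlgebra p) D.X ∧ Module.IsTorsion (IwasawaAlgebra p) D.X ∧
      ∃ e : ℤ_[p], e ≠ 0 ∧ PowerSeries.constantCoeff f *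
          (Nat.card (AddCommGroup.primaryComponent W.toAffine.Point p) : ℤ_[p]) ^ 2 =
        e * Nat.card (W.selmerGroupPInfty p) * ∏ v ∈ S, Nat.card (W.localTowerKerPrimary κ (v.adicCompletion ℚ) 0) := by
  have hprime : p.Prime := hp.out
  -- finiteness of the local tower kernels on `S` and of `ker g₀`
  have hT : ∀ v ∈ S, Finite (W.localTowerKerPrimary κ (v.adicCompletion ℚ) 0) := fun v _ ↦ by
    by_cases hpv : ((p : ℕ) : 𝓞 ℚ) ∈ v.asIdeal
    · obtain ⟨B, hB⟩ := MultTowerControl.exists_natCard_localTowerKerPrimary_le_multiplicative W hmult κ hκ v hpv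
      exact (hB 0).1
    · exact W.finite_localTowerKerPrimary_zero_of_not_mem κ hpv
  have hg : Finite (W.KerG κ 0) :=
    W.finite_kerG_zero_of_finite_localTowerKerPrimary_dvd κ fun v hpv ↦ by
      obtain ⟨B, hB⟩ := MultTowerControl.exists_natCard_localTowerKerPrimary_le_multiplicative W hmult κ hκ v hpv
      exact (hB 0).1
  -- Lemmas 4.2/4.3: `f(0) · #(Sel_∞)_γ · #E[p^∞]^{Γ_ℚ} = u · #Sel · #(A₀/Sel₀)`
  obtain ⟨hFG, hX, -, hCofin, -, u, hu⟩ :=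
    D.constantCoeff_charGenerator_mul_natCard_of_finite_selmerGroup_rat W hγ ‹_› hg f hf
  haveI := hCofin
  refine ⟨hFG, hX, ?_⟩
  -- Lemma 4.7, the «≥» half: `∏#𝒦 · #(Sel_∞)_γ ≤ #(A₀/Sel₀) · #C`
  have hineq := prod_natCard_mul_natCard_endCoinvariants_le W p κ hκ hγ ‹_›
    (InputsGreenbergShaTwoAnyTorsion.forall_exists_conjH1_sub_eq_real W p κ hγ)
    (fun v c hc hfix ↦ MultLocSurj.exists_primary_resOfLe_eq_of_forall_conjH1_eq_all_nonsplit W hmult hns κ v c hc hfix)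
    S hS v₀ hv₀ δ hδ hT
  -- the four orders are powers of `p` (`#E[p^∞]^{Γ_ℚ} = #E(ℚ)(p)`; the `DecidableEq ℚ` instances behind the two group laws
  -- on `E(ℚ)` are identified first)
  rw [natCard_fixedPoints_geomPrimaryTorsion_eq W p] at hu
  have hdec : (fun a b : ℚ => Classical.propDecidable (a = b)) = instDecidableEqRat := Subsingleton.elim _ _
  rw [hdec] at hu
  obtain ⟨hEfin, -⟩ := (W.finite_selmerGroupPInfty_iff p).mp ‹_›
  haveI := hEfin
  obtain ⟨a, ha⟩ : ∃ a : ℕ, ∏ v ∈ S, Nat.card (W.localTowerKerPrimary κ (v.adicCompletion ℚ) 0) = p ^ a := by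
    have hv : ∀ v ∈ S, ∃ a : ℕ, Nat.card (W.localTowerKerPrimary κ (v.adicCompletion ℚ) 0) = p ^ a := fun v hv ↦ by
      haveI := hT v hv
      exact exists_natCard_eq_pow p fun x ↦ by
        obtain ⟨-, k, hk⟩ := (W.mem_localTowerKerPrimary_iff κ _ 0 _).mp x.2
        exact ⟨k, Subtype.ext (by rw [AddSubgroupClass.coe_nsmul, hk, ZeroMemClass.coe_zero])⟩
    choose! e he using hv
    exact ⟨∑ v ∈ S, e v, by rw [← Finset.prod_pow_eq_pow_sum]; exact Finset.prod_congr rfl he⟩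
  obtain ⟨b, hb⟩ : ∃ b : ℕ, Nat.card (EndCoinvariants (W.conjSelmerInfty κ γ - 1)) = p ^ b :=
    exists_natCard_eq_pow p fun x ↦ by
      induction x using QuotientAddGroup.induction_on with
      | H s =>
        obtain ⟨k, hk⟩ := W.exists_pow_smul_subgroupH1_ker_eq_zero κ (s : W.subgroupH1 p κ.kerSubgroup)
        refine ⟨k, ?_⟩
        have hs : p ^ k • s = 0 := Subtype.ext (by rw [AddSubgroupClass.coe_nsmul, hk, ZeroMemClass.coe_zero])
        rw [← QuotientAddGroup.mk_nsmul, hs, QuotientAddGroup.mk_zero]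
  obtain ⟨c, hc⟩ : ∃ c : ℕ, Nat.card (W.KerG κ 0) = p ^ c :=
    exists_natCard_eq_pow p fun x ↦ by
      induction x using QuotientAddGroup.induction_on with
      | H y =>
        obtain ⟨k, hk⟩ := W.exists_pow_smul_subgroupH1_layer_eq_zero κ 0 (y : W.subgroupH1 p (κ.layerSubgroup 0))
        refine ⟨k, ?_⟩
        have hy : p ^ k • y = 0 := Subtype.ext (by rw [AddSubgroupClass.coe_nsmul, hk, ZeroMemClass.coe_zero])
        rw [← QuotientAddGroup.mk_nsmul, hy, QuotientAddGroup.mk_zero]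
  obtain ⟨d, hd⟩ : ∃ d : ℕ, Nat.card (AddCommGroup.primaryComponent W.toAffine.Point p) = p ^ d :=
    exists_natCard_eq_pow p fun P ↦ by
      obtain ⟨k, hk⟩ := (AddCommGroup.mem_primaryComponent).mp P.2
      exact ⟨k, Subtype.ext (by rw [AddSubgroupClass.coe_nsmul, hk, ZeroMemClass.coe_zero])⟩
  -- `a + b ≤ c + d`
  have hle : a + b ≤ c + d := by
    have h := hineq.trans (Nat.mul_le_mul_left _ hC)
    rw [ha, hb, hc, hd, ← pow_add, ← pow_add] at h
    exact (Nat.pow_le_pow_iff_right hprime.one_lt).mp h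
  obtain ⟨m, hm⟩ := Nat.exists_eq_add_of_le hle
  -- multiply out in `ℤ_p`
  rw [hb, hd, hc] at hu
  push_cast at hu
  refine ⟨u * (p : ℤ_[p]) ^ m, mul_ne_zero (Units.ne_zero u) (pow_ne_zero _ (by exact_mod_cast hprime.ne_zero)), ?_⟩
  rw [ha, hd]
  push_cast
  have hb0 : ((p : ℤ_[p]) ^ b) ≠ 0 := pow_ne_zero _ (by exact_mod_cast hprime.ne_zero)
  have hpow : ((p : ℤ_[p]) ^ c) * (p : ℤ_[p]) ^ d = (p : ℤ_[p]) ^ a * (p : ℤ_[p]) ^ b * (p : ℤ_[p]) ^ m := by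
    rw [← pow_add, ← pow_add, ← pow_add, hm]
  refine mul_right_cancel₀ hb0 ?_
  calc PowerSeries.constantCoeff f * ((p : ℤ_[p]) ^ d) ^ 2 * (p : ℤ_[p]) ^ b
      = (PowerSeries.constantCoeff f * (p : ℤ_[p]) ^ b * (p : ℤ_[p]) ^ d) * (p : ℤ_[p]) ^ d := by ring
    _ = (u : ℤ_[p]) * Nat.card (W.selmerGroupPInfty p) * (p : ℤ_[p]) ^ c * (p : ℤ_[p]) ^ d := by rw [hu]
    _ = (u : ℤ_[p]) * Nat.card (W.selmerGroupPInfty p) * ((p : ℤ_[p]) ^ c * (p : ℤ_[p]) ^ d) := by ring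
    _ = (u : ℤ_[p]) * Nat.card (W.selmerGroupPInfty p) * ((p : ℤ_[p]) ^ a * (p : ℤ_[p]) ^ b * (p : ℤ_[p]) ^ m) := by
          rw [hpow]
    _ = (u : ℤ_[p]) * (p : ℤ_[p]) ^ m * Nat.card (W.selmerGroupPInfty p) * (p : ℤ_[p]) ^ a * (p : ℤ_[p]) ^ b := by ring

/-! ## §2 `p = 2`: the upper-half of the display `X5.O1.TwoAdicEulerCharRankZeroNonsplitMult W 0`, any rational `2`-torsion -/

/-- `ord_p` of a product of non-zero naturals is the sum of the `ord_p` (copy of the private helper of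
`…Theorems.MultEulerChar`). [folklore] -/
private theorem padicValNat_prod {ι : Type*} (p : ℕ) [Fact p.Prime] (s : Finset ι) (f : ι → ℕ)
    (hf : ∀ i ∈ s, f i ≠ 0) : padicValNat p (∏ i ∈ s, f i) = ∑ i ∈ s, padicValNat p (f i) := by
  induction s using Finset.induction_on with
  | empty => simp
  | insert a s ha ih =>
    rw [Finset.prod_insert ha, Finset.sum_insert ha,
      padicValNat.mul (hf a (Finset.mem_insert_self a s))
        (Finset.prod_ne_zero_iff.mpr fun i hi ↦ hf i (Finset.mem_insert_of_mem hi)),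
      ih fun i hi ↦ hf i (Finset.mem_insert_of_mem hi)]

/-- Over `ℚ` a finite place containing the prime `p` is THE place of `p` (copy of the private helper of
`…Theorems.MultEulerChar`). [folklore] -/
private theorem eq_of_natCast_mem {p : ℕ} (hp : p.Prime) {v w : HeightOneSpectrum (𝓞 ℚ)}
    (hv : ((p : ℕ) : 𝓞 ℚ) ∈ v.asIdeal) (hw : ((p : ℕ) : 𝓞 ℚ) ∈ w.asIdeal) : v = w :=
  Rat.HeightOneSpectrum.primesEquiv.injective (Subtype.ext
    ((Rat.HeightOneSpectrum.primesEquiv_eq_of_natCast_mem v hp hv).trans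
      (Rat.HeightOneSpectrum.primesEquiv_eq_of_natCast_mem w hp hw).symm))

/-- The local Tamagawa number of `W/ℚ` at a finite place is non-zero (Silverman, *AEC*, Cor. VII.6.2; copy of the private helper of
`…Theorems.MultEulerChar`). [cite: SilvermanAEC2009, VII.6 Cor. 6.2] -/
private theorem localTamagawaNumber_ne_zero_rat (W : WeierstrassCurve ℚ) [W.IsElliptic] (v : HeightOneSpectrum (𝓞 ℚ)) :
    (W.baseChange (v.adicCompletion ℚ)).localTamagawaNumber (v.adicCompletionIntegers ℚ) ≠ 0 := by
  haveI : Fact (Nat.Prime (Rat.HeightOneSpectrum.primesEquiv v : ℕ)) := ⟨(Rat.HeightOneSpectrum.primesEquiv v).2⟩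
  rw [← localTamagawaNumber_padic_eq_holds W v (Rat.HeightOneSpectrum.primesEquiv v : ℕ) rfl]
  exact localTamagawaNumber_padic_ne_zero_holds (Rat.HeightOneSpectrum.primesEquiv v : ℕ) (W.baseChange ℚ_[Rat.HeightOneSpectrum.primesEquiv v])

/-- **The UPPER HALF of Greenberg's display at a NON-SPLIT `2`, ANY rational `2`-torsion, modulo Cassels' count at `v₀`.** For
`W/ℚ` globally minimal and elliptic, non-split multiplicative at `2`, `κ` the cyclotomic `ℤ₂`-extension with topological
generator `γ`, `Sel_{2^∞}(E/ℚ)` finite, `D` a dual datum with `char X = (f)`, a finite `S ⊇ {bad} ∪ {2}`, `v₀ ∉ S`, a receptacle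
`δ` at `v₀` with `#C ≤ #E(ℚ)(2)` (HYPOTHESIS, Cassels p. 104): **`f(0) · #E(ℚ)(2)² = e · 2^{ord₂ ∏_ℓ c_ℓ + 1} · #Sel_{2^∞}(E/ℚ)`
for some NON-ZERO `e ∈ ℤ₂`** — i.e. `ord₂ f_E(0) + 2·ord₂ #E(ℚ)(2) ≥ ord₂ ∏_ℓ c_ℓ + 1 + ord₂ #Sel`, the direction of the print
display `f_E(0)·#E(ℚ)(2)² = u·2^{ord₂ ∏ c + 1}·#Sel` («If p = 2, then |ker(r_v)| = 2c_v^{(p)}») that the upper-half doors use.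
The local orders: `#𝒦_{v,0}[2^∞] = 2^{ord₂ c_v + 1}` at `v ∋ 2` (GEN 30, `MultTowerNS2LayerZero.natCard_localTowerKerPrimary_zero_eq_nonsplitTwo`),
`= 2^{ord₂ c_v}` at `v ∤ 2` (Lemma 3.3 exact, `Rank1Residual.Additive.natCard_localTowerKerPrimary_zero_eq_pow_of_isCyclotomic`).
[cite: GreenbergLNM1716, Thm. 4.1 (p. 102), §3 Lemma 3.3 (pp. 86–87), p. 93, §4 pp. 104–108, 112–113] -/
theorem constantCoeff_mul_sq_eq_two_nonsplit_of_defect (W : WeierstrassCurve ℚ) [W.IsGloballyMinimal] [W.IsElliptic]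
    (hmult : W.HasMultiplicativeReductionAtPrime 2) (hns : ¬ W.HasSplitMultiplicativeReductionAtPrime 2)
    (κ : ZpExtension ℚ 2) (hκ : κ.IsCyclotomic) {γ : absoluteGaloisGroup ℚ} (hγ : κ.IsTopGenerator γ)
    (D : W.SelmerDualData κ γ) [Finite (W.selmerGroupPInfty 2)]
    (S : Finset (HeightOneSpectrum (𝓞 ℚ))) (hS : ∀ v ∉ S, ((2 : ℕ) : 𝓞 ℚ) ∉ v.asIdeal ∧ W.HasGoodReductionAt v)
    (v₀ : HeightOneSpectrum (𝓞 ℚ)) (hv₀ : v₀ ∉ S)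
    {C : Type*} [AddCommGroup C] [Finite C]
    (δ : AddCommGroup.primaryComponent
      (discreteH1 (localSubgroup (⊤ : Subgroup (absoluteGaloisGroup ℚ)) (v₀.adicCompletion ℚ))
        (localPoints W (v₀.adicCompletion ℚ))) 2 →+ C)
    (hδ : ∀ z : AddCommGroup.primaryComponent
        (discreteH1 (localSubgroup (⊤ : Subgroup (absoluteGaloisGroup ℚ)) (v₀.adicCompletion ℚ))
          (localPoints W (v₀.adicCompletion ℚ))) 2, δ z = 0 ↔
      (z : discreteH1 (localSubgroup (⊤ : Subgroup (absoluteGaloisGroup ℚ)) (v₀.adicCompletion ℚ))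
        (localPoints W (v₀.adicCompletion ℚ))) ∈
        AddSubgroup.map (W.localResOver 2 ⊤ (v₀.adicCompletion ℚ))
          (unramifiedOutside (⊤ : Subgroup (absoluteGaloisGroup ℚ)) (W.geomPrimaryTorsion 2) 2
              ((↑S : Set (HeightOneSpectrum (𝓞 ℚ))) ∪ {v₀}) ⊓
            (⨅ v ∈ S, W.localKerOver 2 ⊤ (v.adicCompletion ℚ)) ⊓
            (⨅ w : InfinitePlace ℚ, W.localKerOver 2 ⊤ w.Completion)))
    (hC : Nat.card C ≤ Nat.card (AddCommGroup.primaryComponent W.toAffine.Point 2))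
    (f : IwasawaAlgebra 2) (hf : Module.charIdeal (IwasawaAlgebra 2) D.X = Ideal.span {f}) :
    Module.Finite (IwasawaAlgebra 2) D.X ∧ Module.IsTorsion (IwasawaAlgebra 2) D.X ∧
      ∃ e : ℤ_[2], e ≠ 0 ∧ PowerSeries.constantCoeff f *
          (Nat.card (AddCommGroup.primaryComponent W.toAffine.Point 2) : ℤ_[2]) ^ 2 =
        e * (2 ^ (padicValNat 2 W.tamagawaProduct + 1) : ℕ) * Nat.card (W.selmerGroupPInfty 2) := by
  -- adapted from `MultEulerChar.constantCoeff_charGenerator_eq_nonsplit_of_layerZeroCount` (GEN 29)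
  obtain ⟨hFG, hX, e, he, hu⟩ := constantCoeff_mul_sq_eq_nonsplit_rat_of_defect 2 W hmult hns κ hκ hγ D S hS v₀ hv₀ δ hδ hC f hf
  refine ⟨hFG, hX, e, he, ?_⟩
  rw [hu, mul_assoc, mul_assoc, mul_comm (Nat.card (W.selmerGroupPInfty 2) : ℤ_[2])]
  congr 2
  -- the place `v₂` of `2` lies in `S`
  set v₂ : HeightOneSpectrum (𝓞 ℚ) := Rat.HeightOneSpectrum.primesEquiv.symm ⟨2, Nat.prime_two⟩ with hv₂def
  have hv₂ : ((2 : ℕ) : 𝓞 ℚ) ∈ v₂.asIdeal := by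
    have h := Rat.HeightOneSpectrum.natCast_natGenerator_mem v₂
    have hgen : Rat.HeightOneSpectrum.natGenerator v₂ = 2 := by
      change ((Rat.HeightOneSpectrum.primesEquiv v₂ : Nat.Primes) : ℕ) = 2
      rw [hv₂def, Equiv.apply_symm_apply]
    rwa [hgen] at h
  have hv₂S : v₂ ∈ S := by
    by_contra h
    exact (hS v₂ h).1 hv₂
  have hgoodS : ∀ v ∉ S, W.HasGoodReductionAt v := fun v hv ↦ (hS v hv).2
  -- evaluate the local orders
  let c : HeightOneSpectrum (𝓞 ℚ) → ℕ := fun v ↦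
    (W.baseChange (v.adicCompletion ℚ)).localTamagawaNumber (v.adicCompletionIntegers ℚ)
  have hsplit := Finset.mul_prod_erase S (fun v ↦ Nat.card (W.localTowerKerPrimary κ (v.adicCompletion ℚ) 0)) hv₂S
  have hne : ∀ v ∈ S.erase v₂, ((2 : ℕ) : 𝓞 ℚ) ∉ v.asIdeal := fun v hv hpv ↦
    (Finset.mem_erase.mp hv).1 (eq_of_natCast_mem Nat.prime_two hpv hv₂)
  have herase : ∏ v ∈ S.erase v₂, Nat.card (W.localTowerKerPrimary κ (v.adicCompletion ℚ) 0) =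
      2 ^ ∑ v ∈ S.erase v₂, padicValNat 2 (c v) := by
    rw [← Finset.prod_pow_eq_pow_sum]
    refine Finset.prod_congr rfl fun v hv ↦ ?_
    exact Rank1Residual.Additive.natCard_localTowerKerPrimary_zero_eq_pow_of_isCyclotomic W hκ (hne v hv)
  -- `∑_{v ∈ S} ord₂ c_v = ord₂ ∏_ℓ c_ℓ`
  have htam : W.tamagawaProduct = ∏ v ∈ S, c v := by
    have hsupp : (Function.mulSupport c) ⊆ (S : Set (HeightOneSpectrum (𝓞 ℚ))) := by
      intro v hv
      by_contra hvS
      exact hv (W.localTamagawaNumber_eq_one_of_hasGoodReductionAt_holds v (hgoodS v hvS))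
    change ∏ᶠ v, c v = _
    rw [finprod_eq_prod_of_mulSupport_subset c hsupp]
  have hsum : padicValNat 2 (c v₂) + ∑ v ∈ S.erase v₂, padicValNat 2 (c v) = padicValNat 2 W.tamagawaProduct := by
    rw [htam, padicValNat_prod 2 _ c fun v _ ↦ localTamagawaNumber_ne_zero_rat W v, ← Finset.add_sum_erase S _ hv₂S]
  have hc₂ : Nat.card (W.localTowerKerPrimary κ (v₂.adicCompletion ℚ) 0) = 2 ^ (padicValNat 2 (c v₂) + 1) :=
    MultTowerNS2LayerZero.natCard_localTowerKerPrimary_zero_eq_nonsplitTwo W hmult hns hκ v₂ hv₂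
  rw [← hsplit, herase, hc₂, ← pow_add, ← hsum]
  ring_nf

end Summit.BirchSwinnertonDyer.BirchSwinnertonDyer.Theorems.TorsionEulerChar

end
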